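import Summits.NavierStokesRegularity.NavierStokesRegularity.Theorems.SoloRefuteBetts2026
import Literature.Analysis.FunctionSpaces.FlatTorusProofs
import Mathlib.Analysis.InnerProductSpace.Adjoint
import HarnessLib

/-!
# Betts (2026), display (72) p.13 — kernel refutation of `Step_L59_72` (records-grade addendum to C153)

`Literature.Claims.NS.Betts2026.Step_L59_72` types display (72) p.13 l.58–60 of Betts2026 («Using
Calderón–Zygmund estimates (Section 7) and elliptic regularity: ‖S‖_{L²} ≤ C‖∇E‖_{L²}», `C` absolute)
for every smooth periodic solution, its flow map and every time of the slab `[0,T)`.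

**It fails at `t = 0` for every viscosity and every constant**, by the print's own normalisation
`Φ₀ = id` ((14) p.4, Remark 3.7 p.7): `E(·,0) = 0`, so `‖∇E(0)‖_{L²} = 0` (skeleton `gradESq_zero`),
while `‖S(0)‖_{L²} > 0` for any datum with a non-zero strain — here the decaying shear
`u(t,x) = e^{−4π²νt} sin(2πx₁) e₀` of the C153 kit (`SoloRefuteBetts2026`: `uS`, `flow`,
`isSolutionOn_shear`, `isFlowMap_flow`), whose strain `S(x) = π cos(2πx₁)(e₀ ⊗ e₁ + e₁ ⊗ e₀)` has
`⟪S(x) e₁, e₀⟫ = π cos(2πx₁) ≠ 0` at the centre of the cell. The `L²(𝕋³)` norm is the skeleton's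
`torusIntegral` (Bochner integral over `UnitAddTorus (Fin 3)` through the section `Torus.repr`); its
positivity is proved through `Torus.measurePreserving_repr` (the section pushes Haar measure to Lebesgue
measure on the unit cube) and a ball around the centre of the cube on which `|S|² > 0`.

This is a records-grade companion of `not_Step_Thm63` (token of record #136): same countermodel, same
instant `t = 0`; (72) is print-earlier (p.13) than Thm 6.3 (p.15) but is a display inside the proof of
Lemma 5.9, not a binder of `claim_of_steps`.

[cite: Betts2026, (72) p.13 l.58–60; (14) p.4; Remark 3.7 p.7 l.48–52]
-/

set_option linter.dupNamespace false

noncomputable section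

open Set MeasureTheory Filter Function Real
open scoped ContDiff ENNReal NNReal Topology InnerProductSpace

namespace Summit.NavierStokesRegularity.NavierStokesRegularity.Theorems.Betts2026

open Literature.Analysis Literature.Analysis.FluidPDE Literature.Analysis.FunctionSpaces
open Literature.Claims.NS.Betts2026
open Literature.Claims.NS.Rockwell2025 (IsFlowMap)

/-! ## The strain of the shear datum -/

/-- `∇u₀(y) = e₀ ⊗ (2π cos(2πy₁)) e₁`, i.e. `h ↦ h₁ · 2π cos(2πy₁) e₀`. [folklore] -/
theorem fderiv_uS_zero (ν : ℝ) (y : E3) :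
    fderiv ℝ (uS ν 0) y = (EuclideanSpace.proj (1 : Fin 3) : E3 →L[ℝ] ℝ).smulRight
      ((2 * π * cos (2 * π * y 1)) • EuclideanSpace.single (0 : Fin 3) (1 : ℝ)) := by
  have hd : Differentiable ℝ (phi ν 0) := fun z => (hasDerivAt_phi_y ν 0 z).differentiableAt
  have h := ParallelShear.fderiv_profile hd y
  change fderiv ℝ (uS ν 0) y = _ at h
  rw [h, deriv_phi]
  simp

/-- `⟪S(y) e₁, e₀⟫ = π cos(2πy₁)` for the strain `S = ½(∇u₀ + ∇u₀ᵀ)` of the shear datum. [folklore] -/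
theorem inner_strainOp_uS (ν : ℝ) (y : E3) :
    ⟪strainOp (uS ν 0) y (EuclideanSpace.single 1 1), EuclideanSpace.single 0 1⟫_ℝ =
      π * cos (2 * π * y 1) := by
  rw [strainOp, fderiv_uS_zero, ContinuousLinearMap.star_eq_adjoint]
  simp only [smul_apply, add_apply, inner_add_left, real_inner_smul_left,
    ContinuousLinearMap.adjoint_inner_left, ContinuousLinearMap.smulRight_apply]
  simp
  ring

/-- The strain of the shear datum is non-zero wherever `cos(2πy₁) ≠ 0`. [folklore] -/
theorem strainOp_uS_ne_zero (ν : ℝ) {y : E3} (hy : cos (2 * π * y 1) ≠ 0) :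
    strainOp (uS ν 0) y ≠ 0 := by
  intro h0
  have h := inner_strainOp_uS ν y
  rw [h0, zero_apply, inner_zero_left] at h
  exact hy ((mul_eq_zero.1 h.symm).resolve_left pi_ne_zero)

/-- The constant `2π ‖proj₁‖ ‖e₀‖` bounding `‖∇u₀‖` and `‖S‖` uniformly. [folklore] -/
def Mb : ℝ :=
  2 * π * (‖(EuclideanSpace.proj (1 : Fin 3) : E3 →L[ℝ] ℝ)‖ *
    ‖(EuclideanSpace.single (0 : Fin 3) (1 : ℝ) : E3)‖)

/-- A uniform bound: `‖S(y)‖ ≤ 2π ‖proj₁‖ ‖e₀‖`. [folklore] -/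
theorem norm_strainOp_uS_le (ν : ℝ) (y : E3) : ‖strainOp (uS ν 0) y‖ ≤ Mb := by
  have hA : ‖fderiv ℝ (uS ν 0) y‖ ≤ Mb := by
    rw [fderiv_uS_zero, ContinuousLinearMap.norm_smulRight_apply, norm_smul, Mb]
    have hc : ‖2 * π * cos (2 * π * y 1)‖ ≤ 2 * π := by
      rw [Real.norm_eq_abs, abs_mul, abs_of_pos (by positivity : (0:ℝ) < 2 * π)]
      exact mul_le_of_le_one_right (by positivity) (abs_cos_le_one _)
    calc ‖(EuclideanSpace.proj (1 : Fin 3) : E3 →L[ℝ] ℝ)‖ *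
          (‖2 * π * cos (2 * π * y 1)‖ * ‖(EuclideanSpace.single (0 : Fin 3) (1 : ℝ) : E3)‖)
        ≤ ‖(EuclideanSpace.proj (1 : Fin 3) : E3 →L[ℝ] ℝ)‖ *
          ((2 * π) * ‖(EuclideanSpace.single (0 : Fin 3) (1 : ℝ) : E3)‖) :=
          mul_le_mul_of_nonneg_left (mul_le_mul_of_nonneg_right hc (norm_nonneg _)) (norm_nonneg _)
      _ = _ := by ring
  rw [strainOp, ContinuousLinearMap.star_eq_adjoint, norm_smul]
  have hadj : ‖ContinuousLinearMap.adjoint (fderiv ℝ (uS ν 0) y)‖ = ‖fderiv ℝ (uS ν 0) y‖ :=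
    ContinuousLinearMap.adjoint.norm_map _
  calc ‖(1 / 2 : ℝ)‖ * ‖fderiv ℝ (uS ν 0) y + ContinuousLinearMap.adjoint (fderiv ℝ (uS ν 0) y)‖
      ≤ ‖(1 / 2 : ℝ)‖ * (‖fderiv ℝ (uS ν 0) y‖ + ‖ContinuousLinearMap.adjoint (fderiv ℝ (uS ν 0) y)‖) :=
        mul_le_mul_of_nonneg_left (norm_add_le _ _) (norm_nonneg _)
    _ = ‖fderiv ℝ (uS ν 0) y‖ := by rw [hadj]; norm_num; ring
    _ ≤ _ := hA

/-- `y ↦ |S(y)|²` is continuous (the datum is smooth; `A ↦ Aᵀ` is the adjoint isometry). [folklore] -/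
theorem continuous_normSq_strainOp_uS (ν : ℝ) :
    Continuous fun y : E3 => ‖strainOp (uS ν 0) y‖ ^ 2 := by
  have hF : Continuous (fderiv ℝ (uS ν 0)) := (isDatum_shear ν).smooth.continuous_fderiv (by simp)
  have hadj : Continuous fun A : Op => ContinuousLinearMap.adjoint A :=
    (ContinuousLinearMap.adjoint : Op ≃ₗᵢ⋆[ℝ] Op).continuous
  have hS : Continuous fun y : E3 => strainOp (uS ν 0) y := by
    have h : (fun y : E3 => strainOp (uS ν 0) y) = fun y =>
        (1 / 2 : ℝ) • (fderiv ℝ (uS ν 0) y + ContinuousLinearMap.adjoint (fderiv ℝ (uS ν 0) y)) := by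
      funext y; rw [strainOp, ContinuousLinearMap.star_eq_adjoint]
    rw [h]
    exact (hF.add (hadj.comp hF)).const_smul (1 / 2 : ℝ)
  exact hS.norm.pow 2

/-! ## `‖S(0)‖²_{L²(𝕋³)} > 0` -/

/-- The centre `(½,½,½)` of the unit cell. [folklore] -/
def xc : E3 := WithLp.toLp 2 fun _ : Fin 3 => (1 / 2 : ℝ)

/-- Coordinates of the centre. [folklore] -/
@[simp] theorem xc_apply (i : Fin 3) : xc i = 1 / 2 := rfl

/-- The ball of radius `¼` about the centre lies in the unit cell `[0,1)³`. [folklore] -/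
theorem ball_xc_subset_unitCube : Metric.ball xc (1 / 4) ⊆ Torus.unitCube (Fin 3) := by
  intro y hy
  rw [Torus.mem_unitCube]
  intro i
  have h1 : |(y - xc) i| ≤ ‖y - xc‖ := by
    have := PiLp.norm_apply_le (y - xc) i
    rwa [Real.norm_eq_abs] at this
  rw [Metric.mem_ball, dist_eq_norm] at hy
  have h2 : |y i - 1 / 2| < 1 / 4 := by
    have : (y - xc) i = y i - 1 / 2 := by simp
    rw [← this]; exact lt_of_le_of_lt h1 hy
  rw [abs_lt] at h2
  constructor <;> linarith [h2.1, h2.2]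

/-- **`‖S(0)‖_{L²(𝕋³)} > 0` for the shear datum.** [folklore] -/
theorem strainSq_uS_pos (ν : ℝ) : 0 < strainSq (uS ν) 0 := by
  set g : E3 → ℝ := fun y => ‖strainOp (uS ν 0) y‖ ^ 2 with hg
  have hgc : Continuous g := continuous_normSq_strainOp_uS ν
  have hg0 : ∀ y, 0 ≤ g y := fun y => by positivity
  have hgM : ∀ y, g y ≤ Mb ^ 2 := fun y =>
    pow_le_pow_left₀ (norm_nonneg _) (norm_strainOp_uS_le ν y) 2
  -- positivity at the centre and on a ball around it
  have hgc0 : 0 < g xc := by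
    have hne : strainOp (uS ν 0) xc ≠ 0 := by
      refine strainOp_uS_ne_zero ν ?_
      rw [xc_apply, show 2 * π * (1 / 2 : ℝ) = π by ring, cos_pi]
      norm_num
    have := norm_pos_iff.2 hne
    positivity
  obtain ⟨δ, hδ0, hδ⟩ := Metric.continuousAt_iff.1 hgc.continuousAt (g xc / 2) (by positivity)
  set r : ℝ := min δ (1 / 4) with hr
  have hr0 : 0 < r := lt_min hδ0 (by norm_num)
  have hrsub : Metric.ball xc r ⊆ Torus.unitCube (Fin 3) :=
    (Metric.ball_subset_ball (min_le_right _ _)).trans ball_xc_subset_unitCube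
  have hrpos : ∀ y ∈ Metric.ball xc r, 0 < g y := by
    intro y hy
    have hy' : dist y xc < δ := lt_of_lt_of_le (Metric.mem_ball.1 hy) (min_le_left _ _)
    have h := hδ hy'
    rw [Real.dist_eq, abs_lt] at h
    linarith [h.1]
  -- the torus integral
  change 0 < ∫ a : UnitAddTorus (Fin 3), g (Torus.repr a)
  have hmeas : Measurable fun a : UnitAddTorus (Fin 3) => g (Torus.repr a) :=
    hgc.measurable.comp Torus.measurable_repr
  have hint : Integrable (fun a : UnitAddTorus (Fin 3) => g (Torus.repr a)) volume := by
    refine (integrable_const (Mb ^ 2)).mono' hmeas.aestronglyMeasurable (Eventually.of_forall fun a => ?_)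
    rw [Real.norm_eq_abs, abs_of_nonneg (hg0 _)]
    exact hgM _
  rw [integral_pos_iff_support_of_nonneg (fun a => hg0 _) hint]
  calc (0 : ℝ≥0∞) < volume (Metric.ball xc r) := Metric.measure_ball_pos volume xc hr0
    _ = volume ((Torus.repr : UnitAddTorus (Fin 3) → E3) ⁻¹' Metric.ball xc r) := by
        rw [Torus.measurePreserving_repr.measure_preimage measurableSet_ball.nullMeasurableSet,
          Measure.restrict_apply measurableSet_ball, inter_eq_left.2 hrsub]
    _ ≤ volume (support fun a : UnitAddTorus (Fin 3) => g (Torus.repr a)) :=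
        measure_mono fun a ha => Function.mem_support.2 (hrpos _ ha).ne'

/-! ## The refutation -/

/-- **(72) fails at `t = 0` along the decaying shear, for every `ν > 0` and every constant `C`.**
[cite: Betts2026, (72) p.13 l.58–60; (14) p.4; Remark 3.7 p.7] -/
theorem l5972_fails_at {ν : ℝ} (hν : 0 < ν) (C : ℝ) :
    ¬ (Real.sqrt (strainSq (uS ν) 0) ≤ C * Real.sqrt (gradESq (flow ν) 0)) := by
  rw [Literature.Claims.NS.Betts2026.gradESq_zero (isFlowMap_flow hν 1), Real.sqrt_zero, mul_zero,
    not_le]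
  exact Real.sqrt_pos.2 (strainSq_uS_pos ν)

/-- **Refutes `Step_L59_72`** ((72) p.13 l.58–60 «‖S‖_{L²} ≤ C‖∇E‖_{L²}», typed for every time of
the slab): at `t = 0` the right side vanishes for every flow map (`E(·,0) = 0`, skeleton
`gradESq_zero`), the left side is `‖S(u₀)‖_{L²(𝕋³)} > 0` for the decaying shear (here `ν = 1`, `T = 1`).
[cite: Betts2026, (72) p.13 l.58–60; (14) p.4; Remark 3.7 p.7 l.48–52] -/
theorem not_Step_L59_72 : ¬ Step_L59_72 := by
  rintro ⟨C, hC⟩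
  exact l5972_fails_at one_pos C (hC 1 one_pos (uS 1 0) (isDatum_shear 1) 1 (uS 1) pS (flow 1)
    one_pos (isSolutionOn_shear 1 1) (isFlowMap_flow one_pos 1) 0 ⟨le_rfl, one_pos⟩)

/-- info: 'Summit.NavierStokesRegularity.NavierStokesRegularity.Theorems.Betts2026.not_Step_L59_72' depends on axioms: [propext, Classical.choice, Quot.sound] -/
#guard_msgs (whitespace := lax) in
#print axioms not_Step_L59_72

end Summit.NavierStokesRegularity.NavierStokesRegularity.Theorems.Betts2026

end
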